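import Summits.RiemannHypothesis.RiemannHypothesis.Theorems.PfPersistenceDilatingLandauWeightedMellin
import Literature.NumberTheory.LFunctions.LogRieszAbelIntegral
import Literature.NumberTheory.LFunctions.ChebyshevHalfLineBias
import HarnessLib

/-!
# LANDAU for the half-line Chebyshev bias `Σ_{n≤x} Λ(n) n^{-1/2} log(x/n) − 4√x` — I: Mellin side

Cell `pub-rhpf` (mechanism/rigidity campaign; **no RH claims**), CAND SEAT 7 gen 8, CASE-DAG v6 §6
kernel target LANDAU, third statistic: the LOG-RIESZ dilating statistic
`R(x) = Σ_{n≤x} Λ(n) n^{-1/2} log(x/n) = log x · Σ_{n≤x} Λ(n) n^{-1/2} K(log n/log x)` with the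
triangular kernel `K(u) = (1 − u)₊`, whose centred form `B(x) = R(x) − 4√x` is the tree's
`Literature.NumberTheory.LFunctions.chebyshevHalfLineBias` (M. Suzuki, *On variants of Chebyshev's
conjecture*, Ramanujan J. 68 (2025) 95 = arXiv:2411.07436, (1.5); named fact `Suzuki2024_thm1`:
RH ⟺ `B(x) ≤ 0` for all large `x`). File 1 of 3 (`…HalfLineBiasMellin` → `…HalfLineBiasLandau` →
`…HalfLineBiasDictionary`); the three together PROVE the Landau half `(ii) ⇒ (i)` of Suzuki's
Theorem 1 (eventual `B ≤ 0` ⇒ RH), graded by power scales.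

This file: `R` as `S(x) log x − Σ_{n≤x} Λ(n) n^{-1/2} log n` (`wR`; `S = wpsi` of
`PfPersistenceDilatingLandauWeightedMellin`), its identification with the log-Riesz mean and with
`chebyshevHalfLineBias` (§1); growth `|R(x)| ≤ 2(log 4 + 4) x^{3/2}`; the Mellin transform on
`Re s > 2` by integration by parts through the right derivative `R'(x) = S(x)/x`
(`LogRieszAbel.hasDerivWithinAt_logRiesz`): `∫_1^∞ R(x) x^{-s-1} dx = (1/s) ∫_1^∞ S(x) x^{-s-1} dx
= ((s − 1/2)⁻¹ − ζ₁'/ζ₁(s + 1/2))/s²`, hence `∫_1^∞ B(x) x^{-s-1} dx = −(ζ₁'/ζ₁(s + 1/2) + 4s + 2)/s²`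
(§2); the comparison function `A = c x^b − η B`, the kernel `(ζ₁'/ζ₁(s + 1/2) + 4s + 2)/s²` and
`∫_1^∞ A x^{-s-1} dx = c/(s − b) + η · kernel` on `Re s > 2` (§3). All RH-free, sorry-free.

References: [Suzuki2024] M. Suzuki, arXiv:2411.07436, Thm. 1, (1.5); [MontgomeryVaughan2007]
H. L. Montgomery, R. C. Vaughan, *Multiplicative Number Theory I*, CUP 2007, §15.1, §2.1.
-/

noncomputable section

-- the sub-problem path RiemannHypothesis/RiemannHypothesis duplicates a namespace (D-0017)
set_option linter.dupNamespace false

open Complex Filter Topology Set MeasureTheory Metric Asymptotics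

namespace Summit.RiemannHypothesis.RiemannHypothesis.Theorems.PfPersistenceHalfLineBiasMellin

open Literature.NumberTheory.LFunctions
open Literature.NumberTheory.LFunctions.Landau
open Summit.RiemannHypothesis.RiemannHypothesis.Theorems.PfPersistenceDilatingLandauWeightedMellin

/-! ## §1 The log-Riesz mean `R(x) = Σ_{n≤x} Λ(n) n^{-1/2} log(x/n)` and the half-line bias -/

/-- `T(m) = Σ_{1 ≤ k ≤ m} Λ(k) k^{-1/2} log k`. [folklore] -/
def wT (m : ℕ) : ℝ := ∑ k ∈ Finset.Icc 1 m, wcoef k * Real.log k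

/-- `R(x) = S(x) log x − T(⌊x⌋) = Σ_{n≤x} Λ(n) n^{-1/2} log(x/n)`, the log-Riesz mean of `S`.
[cite: Suzuki2024, (1.5)] -/
def wR (x : ℝ) : ℝ := wpsi x * Real.log x - wT ⌊x⌋₊

/-- The half-line Chebyshev bias `B(x) = R(x) − 4√x` (equal to `chebyshevHalfLineBias x` for
`x > 0`, `hlb_eq_chebyshevHalfLineBias`). [cite: Suzuki2024, (1.5)] -/
def hlb (x : ℝ) : ℝ := wR x - 4 * x ^ (1 / 2 : ℝ)

/-- `R(x) = Σ_{n ≤ x} Λ(n) n^{-1/2} log(x/n)` for `x > 0`. [cite: Suzuki2024, (1.5)] -/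
theorem wR_eq {x : ℝ} (hx : 0 < x) :
    wR x = ∑ n ∈ Finset.Icc 1 ⌊x⌋₊, wcoef n * Real.log (x / n) := by
  unfold wR wT wpsi wpsiNat
  rw [Finset.sum_mul, ← Finset.sum_sub_distrib]
  refine Finset.sum_congr rfl fun n hn ↦ ?_
  have hn0 : (0 : ℝ) < n := by exact_mod_cast (Finset.mem_Icc.1 hn).1
  rw [Real.log_div hx.ne' hn0.ne']
  ring

/-- `B = chebyshevHalfLineBias` on `x > 0`. [cite: Suzuki2024, (1.5)] -/
theorem hlb_eq_chebyshevHalfLineBias {x : ℝ} (hx : 0 < x) : hlb x = chebyshevHalfLineBias x := by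
  unfold hlb chebyshevHalfLineBias
  rw [wR_eq hx, Real.sqrt_eq_rpow]
  congr 1
  refine Finset.sum_congr rfl fun n _ ↦ ?_
  rw [Real.sqrt_eq_rpow]
  rfl

/-- `R` is measurable. [folklore] -/
theorem measurable_wR : Measurable wR :=
  (measurable_wpsi.mul Real.measurable_log).sub
    ((measurable_from_nat (f := wT)).comp Nat.measurable_floor)

/-- `B` is measurable. [folklore] -/
theorem measurable_hlb : Measurable hlb :=
  measurable_wR.sub (measurable_const.mul (measurable_id.pow_const _))

/-- `R(x) ≥ 0` for `x ≥ 1`. [folklore] -/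
theorem wR_nonneg {x : ℝ} (hx : 1 ≤ x) : 0 ≤ wR x := by
  rw [wR_eq (by linarith)]
  refine Finset.sum_nonneg fun n hn ↦ mul_nonneg (wcoef_nonneg n) (Real.log_nonneg ?_)
  have hn' := Finset.mem_Icc.1 hn
  have hn0 : (0 : ℝ) < n := by exact_mod_cast hn'.1
  have hnx : (n : ℝ) ≤ x := le_trans (by exact_mod_cast hn'.2) (Nat.floor_le (by linarith))
  rwa [le_div_iff₀ hn0, one_mul]

/-- `R(x) ≤ S(x) log x` (for every real `x`). [folklore] -/
theorem wR_le (x : ℝ) : wR x ≤ wpsi x * Real.log x := by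
  have hT : 0 ≤ wT ⌊x⌋₊ := Finset.sum_nonneg fun k hk ↦
    mul_nonneg (wcoef_nonneg k) (Real.log_nonneg (by exact_mod_cast (Finset.mem_Icc.1 hk).1))
  unfold wR
  linarith

/-- Growth: `|R(x)| ≤ 2 (log 4 + 4) x^{3/2}` for `x > 1` (Chebyshev and `log x ≤ 2√x`). [folklore] -/
theorem abs_wR_le {x : ℝ} (hx : 1 < x) : |wR x| ≤ 2 * (Real.log 4 + 4) * x ^ (3 / 2 : ℝ) := by
  have hx0 : 0 < x := by linarith
  have hlog : Real.log x ≤ 2 * x ^ (1 / 2 : ℝ) := by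
    have h := Real.log_le_rpow_div hx0.le (by norm_num : (0 : ℝ) < 1 / 2)
    have : x ^ (1 / 2 : ℝ) / (1 / 2) = 2 * x ^ (1 / 2 : ℝ) := by ring
    linarith
  have h32 : x * x ^ (1 / 2 : ℝ) = x ^ (3 / 2 : ℝ) := by
    rw [show (3 / 2 : ℝ) = 1 + 1 / 2 by norm_num, Real.rpow_add hx0, Real.rpow_one]
  have hl4 : 0 ≤ Real.log 4 + 4 := by linarith [Real.log_nonneg (by norm_num : (1 : ℝ) ≤ 4)]
  rw [abs_of_nonneg (wR_nonneg hx.le)]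
  calc wR x ≤ wpsi x * Real.log x := wR_le x
    _ ≤ ((Real.log 4 + 4) * x) * (2 * x ^ (1 / 2 : ℝ)) :=
        mul_le_mul (wpsi_le x hx0.le) hlog (Real.log_nonneg hx.le) (by positivity)
    _ = 2 * (Real.log 4 + 4) * x ^ (3 / 2 : ℝ) := by rw [← h32]; ring

/-- Growth: `|B(x)| ≤ (2 (log 4 + 4) + 4) x^{3/2}` for `x > 1`. [folklore] -/
theorem abs_hlb_le {x : ℝ} (hx : 1 < x) : |hlb x| ≤ (2 * (Real.log 4 + 4) + 4) * x ^ (3 / 2 : ℝ) := by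
  have hx0 : 0 < x := by linarith
  have h13 : x ^ (1 / 2 : ℝ) ≤ x ^ (3 / 2 : ℝ) :=
    Real.rpow_le_rpow_of_exponent_le hx.le (by norm_num)
  unfold hlb
  calc |wR x - 4 * x ^ (1 / 2 : ℝ)| ≤ |wR x| + |4 * x ^ (1 / 2 : ℝ)| := abs_sub _ _
    _ = |wR x| + 4 * x ^ (1 / 2 : ℝ) := by
        rw [abs_of_nonneg (by positivity : (0 : ℝ) ≤ 4 * x ^ (1 / 2 : ℝ))]
    _ ≤ 2 * (Real.log 4 + 4) * x ^ (3 / 2 : ℝ) + 4 * x ^ (3 / 2 : ℝ) :=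
        add_le_add (abs_wR_le hx) (by linarith)
    _ = (2 * (Real.log 4 + 4) + 4) * x ^ (3 / 2 : ℝ) := by ring

/-- A measurable `g` with `|g(x)| ≤ C x^a` on `(1, ∞)` has `∫_1^∞ |g| x^{-(σ+1)} dx < ∞` for every
`σ > a`. [folklore] -/
theorem integrableOn_rpow_of_abs_le_mul_rpow {g : ℝ → ℝ} (hg : Measurable g) {C a : ℝ}
    (hC : ∀ x, 1 < x → |g x| ≤ C * x ^ a) {σ : ℝ} (hσ : a < σ) :
    IntegrableOn (fun x ↦ g x * x ^ (-(σ + 1))) (Ioi 1) := by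
  have h1 : IntegrableOn (fun x : ℝ ↦ C * x ^ (a - (σ + 1))) (Ioi 1) :=
    (integrableOn_Ioi_rpow_of_lt (by linarith) zero_lt_one).const_mul C
  refine Integrable.mono' h1 ((hg.mul (measurable_id.pow_const _))).aestronglyMeasurable ?_
  rw [ae_restrict_iff' measurableSet_Ioi]
  refine Eventually.of_forall fun x (hx : 1 < x) ↦ ?_
  have hx0 : 0 < x := zero_lt_one.trans hx
  rw [norm_mul, Real.norm_eq_abs, Real.norm_eq_abs, abs_of_pos (Real.rpow_pos_of_pos hx0 _)]
  calc |g x| * x ^ (-(σ + 1)) ≤ C * x ^ a * x ^ (-(σ + 1)) :=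
        mul_le_mul_of_nonneg_right (hC x hx) (Real.rpow_nonneg hx0.le _)
    _ = C * x ^ (a - (σ + 1)) := by
        rw [mul_assoc, ← Real.rpow_add hx0, show a + -(σ + 1) = a - (σ + 1) by ring]

/-! ## §2 The Mellin transform of `R` by integration by parts -/

/-- The Mellin integrand of `R` is integrable on `(1, ∞)` for `Re s > 3/2`. [folklore] -/
theorem integrableOn_wR_cpow {s : ℂ} (hs : 3 / 2 < s.re) :
    IntegrableOn (fun x : ℝ ↦ (wR x : ℂ) * (x : ℂ) ^ (-(s + 1))) (Ioi 1) :=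
  integrable_ofReal_mul_cpow_of_re measurable_wR
    (integrableOn_rpow_of_abs_le_mul_rpow measurable_wR (fun _ hx ↦ abs_wR_le hx) hs)

/-- **Mellin transform of the log-Riesz mean** (integration by parts through the right derivative
`R'(x) = S(x)/x`, `R(1) = 0`, `R(X) X^{-s} → 0`): for `Re s > 2`,
`∫_1^∞ R(x) x^{-s-1} dx = (1/s) ∫_1^∞ S(x) x^{-s-1} dx`. [cite: MontgomeryVaughan2007, §2.1, §5.1] -/
theorem mellinIoi_wR {s : ℂ} (hs : 2 < s.re) : mellinIoi wR s = mellinIoi wpsi s / s := by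
  have hs0 : s ≠ 0 := by rintro rfl; simp at hs; linarith
  have hms : -s ≠ 0 := neg_ne_zero.2 hs0
  have hI1 : IntegrableOn (fun x : ℝ ↦ (wpsi x : ℂ) * (x : ℂ) ^ (-(s + 1))) (Ioi 1) :=
    integrable_ofReal_mul_cpow_of_re measurable_wpsi
      (integrableOn_rpow_of_abs_le_mul_self measurable_wpsi (C := Real.log 4 + 4)
        (fun x hx ↦ by rw [abs_of_nonneg (wpsi_nonneg x)]; exact wpsi_le x (by linarith))
        (by linarith))
  have hI2 := integrableOn_wR_cpow (s := s) (by linarith)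
  -- `G(x) = R(x) x^{-s}` and its right derivative `G'`
  set G : ℝ → ℂ := fun x ↦ (wR x : ℂ) * (x : ℂ) ^ (-s) with hG
  set G' : ℝ → ℂ := fun x ↦ (wpsi x : ℂ) * (x : ℂ) ^ (-(s + 1)) +
    (-s) * ((wR x : ℂ) * (x : ℂ) ^ (-(s + 1))) with hG'
  have hderiv : ∀ X : ℝ, ∀ x ∈ Ioo 1 X, HasDerivWithinAt G (G' x) (Ioi x) x := by
    intro X x hx
    have hx0 : 0 < x := zero_lt_one.trans hx.1
    have hxC : (x : ℂ) ≠ 0 := ofReal_ne_zero.2 hx0.ne'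
    have h1 : HasDerivWithinAt wR (wpsi x / x) (Ioi x) x := by
      have h := LogRieszAbel.hasDerivWithinAt_logRiesz wcoef hx.1.le
      refine h.congr_of_eventuallyEq ?_ (wR_eq hx0)
      exact eventually_of_mem self_mem_nhdsWithin fun t (ht : x < t) ↦ wR_eq (hx0.trans ht)
    have h2 : HasDerivAt (fun y : ℝ ↦ (y : ℂ) ^ (-s)) (-s * (x : ℂ) ^ (-s - 1)) x :=
      hasDerivAt_ofReal_cpow_const hx0.ne' hms
    have h3 := h1.ofReal_comp.mul h2.hasDerivWithinAt
    have hpow : (x : ℂ) ^ (-(s + 1)) = (x : ℂ) ^ (-s) / x := by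
      rw [show -(s + 1) = -s + (-1) by ring, Complex.cpow_add _ _ hxC, Complex.cpow_neg_one,
        div_eq_mul_inv]
    have hG'x : G' x = ((wpsi x / x : ℝ) : ℂ) * (x : ℂ) ^ (-s) +
        (wR x : ℂ) * (-s * (x : ℂ) ^ (-s - 1)) := by
      simp only [hG']
      rw [show -s - 1 = -(s + 1) by ring, hpow]
      push_cast
      field_simp
    rw [hG'x]
    exact h3
  have hcont : ∀ X : ℝ, ContinuousOn G (Icc 1 X) := by
    intro X
    have h1 : ContinuousOn wR (Icc 1 X) :=
      (LogRieszAbel.continuousOn_logRiesz wcoef X).congr fun t ht ↦ wR_eq (by linarith [ht.1])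
    have h2 : ContinuousOn (fun y : ℝ ↦ (y : ℂ) ^ (-s)) (Icc 1 X) := fun t ht ↦
      (hasDerivAt_ofReal_cpow_const (by linarith [ht.1] : t ≠ 0) hms).continuousAt.continuousWithinAt
    exact (continuous_ofReal.comp_continuousOn h1).mul h2
  have hG'int : ∀ X : ℝ, 1 ≤ X → IntervalIntegrable G' volume 1 X := by
    intro X hX
    rw [intervalIntegrable_iff_integrableOn_Ioc_of_le hX]
    exact (hI1.mono_set Ioc_subset_Ioi_self).add ((hI2.mono_set Ioc_subset_Ioi_self).const_mul (-s))
  have hG1 : G 1 = 0 := by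
    simp [hG, wR, wT, wcoef]
  have hFTC : ∀ X : ℝ, 1 ≤ X → ∫ x in (1 : ℝ)..X, G' x = G X := by
    intro X hX
    rw [intervalIntegral.integral_eq_sub_of_hasDeriv_right_of_le hX (hcont X) (hderiv X)
      (hG'int X hX), hG1, sub_zero]
  -- split the interval integral
  have hsplit : ∀ X : ℝ, 1 ≤ X → ∫ x in (1 : ℝ)..X, G' x =
      (∫ x in (1 : ℝ)..X, (wpsi x : ℂ) * (x : ℂ) ^ (-(s + 1))) +
        (-s) * ∫ x in (1 : ℝ)..X, (wR x : ℂ) * (x : ℂ) ^ (-(s + 1)) := by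
    intro X hX
    have i1 : IntervalIntegrable (fun x : ℝ ↦ (wpsi x : ℂ) * (x : ℂ) ^ (-(s + 1))) volume 1 X := by
      rw [intervalIntegrable_iff_integrableOn_Ioc_of_le hX]; exact hI1.mono_set Ioc_subset_Ioi_self
    have i2 : IntervalIntegrable (fun x : ℝ ↦ (wR x : ℂ) * (x : ℂ) ^ (-(s + 1))) volume 1 X := by
      rw [intervalIntegrable_iff_integrableOn_Ioc_of_le hX]; exact hI2.mono_set Ioc_subset_Ioi_self
    simp only [hG']
    rw [intervalIntegral.integral_add i1 (i2.const_mul (-s)), intervalIntegral.integral_const_mul]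
  -- limits as `X → ∞`
  have T1 : Tendsto (fun X : ℝ ↦ ∫ x in (1 : ℝ)..X, (wpsi x : ℂ) * (x : ℂ) ^ (-(s + 1))) atTop
      (𝓝 (mellinIoi wpsi s)) :=
    intervalIntegral_tendsto_integral_Ioi 1 hI1 tendsto_id
  have T2 : Tendsto (fun X : ℝ ↦ ∫ x in (1 : ℝ)..X, (wR x : ℂ) * (x : ℂ) ^ (-(s + 1))) atTop
      (𝓝 (mellinIoi wR s)) :=
    intervalIntegral_tendsto_integral_Ioi 1 hI2 tendsto_id
  have TG : Tendsto G atTop (𝓝 0) := by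
    have hy : 0 < s.re - 3 / 2 := by linarith
    have hlim : Tendsto (fun X : ℝ ↦ 2 * (Real.log 4 + 4) * X ^ (-(s.re - 3 / 2))) atTop (𝓝 0) := by
      simpa using (tendsto_rpow_neg_atTop hy).const_mul (2 * (Real.log 4 + 4))
    refine squeeze_zero_norm' ?_ hlim
    filter_upwards [eventually_gt_atTop (1 : ℝ)] with X hX
    have hX0 : 0 < X := zero_lt_one.trans hX
    simp only [hG]
    rw [norm_mul, Complex.norm_real, Complex.norm_cpow_eq_rpow_re_of_pos hX0, neg_re,
      Real.norm_eq_abs, show -(s.re - 3 / 2) = 3 / 2 + -s.re by ring, Real.rpow_add hX0, ← mul_assoc]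
    exact mul_le_mul_of_nonneg_right (abs_wR_le hX) (Real.rpow_nonneg hX0.le _)
  have Tsum : Tendsto (fun X : ℝ ↦ (∫ x in (1 : ℝ)..X, (wpsi x : ℂ) * (x : ℂ) ^ (-(s + 1))) +
      (-s) * ∫ x in (1 : ℝ)..X, (wR x : ℂ) * (x : ℂ) ^ (-(s + 1))) atTop
      (𝓝 (mellinIoi wpsi s + (-s) * mellinIoi wR s)) :=
    T1.add (T2.const_mul (-s))
  have Tsum' : Tendsto (fun X : ℝ ↦ (∫ x in (1 : ℝ)..X, (wpsi x : ℂ) * (x : ℂ) ^ (-(s + 1))) +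
      (-s) * ∫ x in (1 : ℝ)..X, (wR x : ℂ) * (x : ℂ) ^ (-(s + 1))) atTop (𝓝 0) := by
    refine TG.congr' ?_
    filter_upwards [eventually_ge_atTop (1 : ℝ)] with X hX
    rw [← hFTC X hX, hsplit X hX]
  have hlim := tendsto_nhds_unique Tsum Tsum'
  rw [eq_div_iff hs0]
  linear_combination -hlim

/-- **Mellin transform of `R`, closed form**: for `Re s > 2`,
`∫_1^∞ R(x) x^{-s-1} dx = ((s − 1/2)⁻¹ − ζ₁'/ζ₁(s + 1/2))/s²`.
[cite: MontgomeryVaughan2007, Thm. 1.3, §15.1; Suzuki2024, §2] -/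
theorem mellinIoi_wR_eq {s : ℂ} (hs : 2 < s.re) :
    mellinIoi wR s = ((s + 1 / 2 - 1)⁻¹ - logDeriv riemannZeta₁ (s + 1 / 2)) / s ^ 2 := by
  rw [mellinIoi_wR hs, mellinIoi_wpsi (by linarith), div_div, sq]

/-- **Mellin transform of the half-line bias**: for `Re s > 2`,
`∫_1^∞ B(x) x^{-s-1} dx = −(ζ₁'/ζ₁(s + 1/2) + 4s + 2)/s²` — the pole at `s = 1/2` cancels against
`4√x`. [cite: Suzuki2024, (1.5); MontgomeryVaughan2007, §15.1] -/
theorem mellinIoi_hlb {s : ℂ} (hs : 2 < s.re) :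
    mellinIoi hlb s = -(logDeriv riemannZeta₁ (s + 1 / 2) + 4 * s + 2) / s ^ 2 := by
  have hIw : Integrable (fun x : ℝ ↦ ((wR x : ℝ) : ℂ) * (x : ℂ) ^ (-(s + 1)))
      (volume.restrict (Ioi 1)) := integrableOn_wR_cpow (by linarith)
  have hIm : Integrable (fun x : ℝ ↦ ((4 * x ^ (1 / 2 : ℝ) : ℝ) : ℂ) * (x : ℂ) ^ (-(s + 1)))
      (volume.restrict (Ioi 1)) := by
    refine integrable_ofReal_mul_cpow_of_re
      (show Measurable (fun x : ℝ ↦ 4 * x ^ (1 / 2 : ℝ)) from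
        measurable_const.mul (measurable_id.pow_const _)) ?_
    refine integrableOn_rpow_of_abs_le_mul_rpow (a := 1 / 2)
      (show Measurable (fun x : ℝ ↦ 4 * x ^ (1 / 2 : ℝ)) from
        measurable_const.mul (measurable_id.pow_const _)) (C := 4) (fun x hx ↦ ?_) (by linarith)
    have hx0 : 0 < x := by linarith
    rw [abs_of_nonneg (by positivity)]
  have hs0 : s ≠ 0 := by rintro rfl; simp at hs; linarith
  have hs2 : s - ((1 / 2 : ℝ) : ℂ) ≠ 0 := by
    intro h; have := congrArg Complex.re h
    simp only [sub_re, ofReal_re, zero_re] at this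
    linarith
  unfold hlb
  rw [Nicolas.mellinIoi_sub' hIw hIm, Nicolas.mellinIoi_const_mul, mellinIoi_wR_eq hs,
    PsiOmega.mellinIoi_rpow (b := 1 / 2) (by linarith : (1 / 2 : ℝ) < s.re)]
  have h12 : ((1 / 2 : ℝ) : ℂ) = 1 / 2 := by norm_num
  rw [h12] at hs2
  rw [h12, show s + 1 / 2 - 1 = s - 1 / 2 by ring]
  set L := logDeriv riemannZeta₁ (s + 1 / 2) with hL
  have h3 : -1 + s * 2 ≠ 0 := by
    intro h; apply hs2; linear_combination h / 2
  have h4 : s * 2 - 1 ≠ 0 := by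
    intro h; apply hs2; linear_combination h / 2
  have h5 : s ^ 2 ≠ 0 := pow_ne_zero 2 hs0
  push_cast
  field_simp
  ring

/-! ## §3 The comparison function and the kernel `(ζ₁'/ζ₁(s + 1/2) + 4s + 2)/s²` -/

namespace BiasLandau

/-- `A(x) = c x^b − η B(x)`. [cite: MontgomeryVaughan2007, §15.1 (proof of Thm. 15.3)] -/
def cmpFnB (c b η : ℝ) (x : ℝ) : ℝ := c * x ^ b - η * hlb x

/-- `A` is measurable. [folklore] -/
theorem measurable_cmpFnB (c b η : ℝ) : Measurable (cmpFnB c b η) :=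
  (measurable_const.mul (measurable_id.pow_const _)).sub (measurable_const.mul measurable_hlb)

/-- `|A(x)| ≤ (c + 2 log 4 + 12) x^{3/2}` on `(1, ∞)` (`c ≥ 0`, `b ≤ 1`, `η = ±1`). [folklore] -/
theorem abs_cmpFnB_le {c b η : ℝ} (hc : 0 ≤ c) (hb : b ≤ 1) (hη : η = 1 ∨ η = -1) {x : ℝ}
    (hx : 1 < x) : |cmpFnB c b η x| ≤ (c + (2 * (Real.log 4 + 4) + 4)) * x ^ (3 / 2 : ℝ) := by
  have hx0 : 0 < x := by linarith
  have hηabs : |η| = 1 := by rcases hη with rfl | rfl <;> norm_num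
  have hxb : x ^ b ≤ x ^ (3 / 2 : ℝ) := Real.rpow_le_rpow_of_exponent_le hx.le (by linarith)
  unfold cmpFnB
  calc |c * x ^ b - η * hlb x|
      ≤ |c * x ^ b| + |η * hlb x| := abs_sub _ _
    _ = c * x ^ b + |hlb x| := by
        rw [abs_mul, abs_mul, hηabs, one_mul, abs_of_nonneg hc,
          abs_of_nonneg (Real.rpow_nonneg hx0.le _)]
    _ ≤ c * x ^ (3 / 2 : ℝ) + (2 * (Real.log 4 + 4) + 4) * x ^ (3 / 2 : ℝ) :=
        add_le_add (mul_le_mul_of_nonneg_left hxb hc) (abs_hlb_le hx)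
    _ = (c + (2 * (Real.log 4 + 4) + 4)) * x ^ (3 / 2 : ℝ) := by ring

/-- The kernel `(ζ₁'/ζ₁(s + 1/2) + 4s + 2)/s² = −∫_1^∞ B(x) x^{-s-1} dx`.
[cite: Suzuki2024, §2; MontgomeryVaughan2007, §15.1 (15.6)] -/
def kernelB (s : ℂ) : ℂ := (logDeriv riemannZeta₁ (s + 1 / 2) + 4 * s + 2) / s ^ 2

/-- The kernel is holomorphic off `s = 0` and off the zeros of `ζ₁(s + 1/2)`.
[cite: MontgomeryVaughan2007, §15.1] -/
theorem differentiableAt_kernelB {s : ℂ} (hs0 : s ≠ 0) (hζ : riemannZeta₁ (s + 1 / 2) ≠ 0) :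
    DifferentiableAt ℂ kernelB s := by
  unfold kernelB
  have h1 : DifferentiableAt ℂ (fun z : ℂ ↦ logDeriv riemannZeta₁ (z + 1 / 2)) s :=
    (PsiOneExplicit.analyticAt_logDeriv_riemannZeta₁ hζ).differentiableAt.comp s
      (differentiableAt_id.add_const _)
  have h2 : DifferentiableAt ℂ (fun z : ℂ ↦ logDeriv riemannZeta₁ (z + 1 / 2) + 4 * z + 2) s :=
    (h1.add (differentiableAt_id.const_mul _)).add_const _
  exact h2.div (differentiableAt_id.pow 2) (pow_ne_zero 2 hs0)

/-- The continuation `Φ(s) = c/(s − b) + η · kernel(s)` of the transform of `A`.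
[cite: MontgomeryVaughan2007, §15.1 (15.6)] -/
def contB (c b η : ℝ) (s : ℂ) : ℂ := c / (s - b) + η * kernelB s

/-- `Φ` is holomorphic off `s = b`, `s = 0` and the zeros of `ζ₁(s + 1/2)`.
[cite: MontgomeryVaughan2007, §15.1] -/
theorem differentiableAt_contB {c b η : ℝ} {s : ℂ} (hsb : s ≠ b) (hs0 : s ≠ 0)
    (hζ : riemannZeta₁ (s + 1 / 2) ≠ 0) : DifferentiableAt ℂ (contB c b η) s := by
  unfold contB
  have d1 : DifferentiableAt ℂ (fun z : ℂ ↦ (c : ℂ) / (z - b)) s :=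
    (differentiableAt_const _).div (differentiableAt_id.sub_const _) (sub_ne_zero.2 hsb)
  exact d1.add ((differentiableAt_kernelB hs0 hζ).const_mul _)

/-- **On the half-plane `Re s > 2`**: `∫_1^∞ A(x) x^{-s-1} dx = c/(s − b) + η · kernel(s)`.
[cite: MontgomeryVaughan2007, §15.1 (15.6)] -/
theorem mellinIoi_cmpFnB {c b η : ℝ} (hb : b < 1) {s : ℂ} (hs : 2 < s.re) :
    mellinIoi (cmpFnB c b η) s = contB c b η s := by
  have hIpow : Integrable (fun x : ℝ ↦ ((c * x ^ b : ℝ) : ℂ) * (x : ℂ) ^ (-(s + 1)))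
      (volume.restrict (Ioi 1)) := by
    refine integrable_ofReal_mul_cpow_of_re
      (show Measurable (fun x : ℝ ↦ c * x ^ b) from measurable_const.mul (measurable_id.pow_const _)) ?_
    have h := Nicolas.integrableOn_const_mul_rpow c
      (Nicolas.integrableOn_rpow_neg_rpow (b := -b) (σ := s.re) (by linarith))
    refine h.congr_fun (fun x _ ↦ ?_) measurableSet_Ioi
    simp only [neg_neg]
  have hIE : Integrable (fun x : ℝ ↦ ((η * hlb x : ℝ) : ℂ) * (x : ℂ) ^ (-(s + 1)))
      (volume.restrict (Ioi 1)) := by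
    refine integrable_ofReal_mul_cpow_of_re
      (show Measurable (fun x : ℝ ↦ η * hlb x) from measurable_const.mul measurable_hlb) ?_
    refine Nicolas.integrableOn_const_mul_rpow η ?_
    exact integrableOn_rpow_of_abs_le_mul_rpow measurable_hlb (fun _ hx ↦ abs_hlb_le hx)
      (by linarith : (3 / 2 : ℝ) < s.re)
  unfold cmpFnB contB kernelB
  rw [Nicolas.mellinIoi_sub' hIpow hIE, Nicolas.mellinIoi_const_mul, Nicolas.mellinIoi_const_mul,
    mellinIoi_hlb hs, PsiOmega.mellinIoi_rpow (lt_trans hb (by linarith : (1 : ℝ) < s.re))]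
  ring

end BiasLandau

end Summit.RiemannHypothesis.RiemannHypothesis.Theorems.PfPersistenceHalfLineBiasMellin

end
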